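import Summits.CriticalPhenomena.SAWScalingLimit.Theorems.SAWDefectDecoherenceObservableToSLERCarvedReductionSqueezeTwoPieceInner
import Summits.CriticalPhenomena.SAWScalingLimit.Theorems.SAWDevelopingMapObservableToSLERestrictionCocycleHelpersLattice
import HarnessLib

/-!
# Two-piece flat domains: the nested admissible lattice FAMILIES with prescribed rows and gates
# (piece (G4′d) of stub 5a4′ `stub_carvedReduction_squeeze`)

Piece of stub 5a4′ `stub_carvedReduction_squeeze` (`TwoPieceAdmRestrictionLimit → MovingCarvingSqueeze`)
of the line `bridge-gate-renewal` (r9) of the crux `SAWDefectDecoherence.ObservableToSLER`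
(stmt-CriticalPhenomena-14005; twin T2b′/T2b″ of stmt-CriticalPhenomena-10472), item (G4′),
conclusion.  For nested bounded domains `Ω' ⊆ Ω`, open, connected, with connected exteriors whose
frontiers are their boundaries (e.g. a Dobrushin domain and a hull subdomain), both FLAT in the
`ρ`-balls about two points `p 0`, `p 1` (`dist ≥ 2ρ`; exact upper half-discs, possibly at
different heights), PRESCRIBED threshold rows `m i δ` (up-faces of row `m i δ` strictly above the
line `im = im (p i)`, their height tending to it) and PRESCRIBED gate up-faces `(g i δ, 0)` of row
`m i δ` with `δ c → p i`, there are vertex families `Λ' δ ⊆ Λ δ` which, for all small `δ`, are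
simply connected and connected, lie in `Ω` resp. `Ω'`, have EXACTLY the rows `≥ m i δ` in
`B(p i, ρ/16)`, carry the vertical gate mid-edges `{(g i δ, 0), (g i δ - e₁, 1)}` as common
boundary mid-edges joined by a self-avoiding walk, exhaust the compacts, and whose gate mid-edges
converge to `p i`: every clause asked of the families by ARL″ (`TwoPieceAdmRestrictionLimit`,
with `ρ/16` for `ρ`) and by `MovingCarvingSqueeze` (inner family of `M`, `ρ' = ρ/16`).

* `eventually_pathIn_of_isCompact` — deep lattice walks: for a compact `K` of the domain,
  eventually every vertex of `K` is joined to the base vertex inside the deep set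
  (`FloorRatio.exists_walk_deep_of_isCompact` + `mem_deep_of_closedBall_subset`);
* `stub_carvedReduction_twoPieceFamily` — the families (fills of the main deep components,
  `exists_twoPieceInner`; nested by `FloorRatio.fill_mono`; exact rows by `pathIn_of_near_window`).

Sources: H. Duminil-Copin, S. Smirnov, Ann. of Math. 175 (2012) §3; G. F. Lawler, O. Schramm,
W. Werner, Proc. Sympos. Pure Math. 72 (2004) §3.4.
-/

noncomputable section

open scoped Topology
open Filter Set Metric
open Literature.Probability.LatticeModels (HexVertex hexGraph hexCenter Site)
open Literature.Probability.RandomPlanarGeometry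
open Literature.Probability.RandomPlanarGeometry.SAW
open Literature.Probability.Percolation (PathIn)

namespace Summit.CriticalPhenomena.SAWScalingLimit.Theorems.ObservableToSLER.Squeeze

open Summit.CriticalPhenomena.SAWScalingLimit.Theorems.ObservableToSLE.FloorRatio

/-- **Deep lattice walks, eventually.**  Let `U` be open and connected, flat in the `ρ`-balls
about `p 0`, `p 1`, with deep sets `S δ` as in `exists_twoPieceInner` for threshold rows `m i δ`
whose up-faces have height tending to `im (p i)`, and base vertices `v₀ δ` within `δ` of
`x₀ ∈ U`.  Then for every compact `K ⊆ U`, for all small `δ` every vertex `v` with `δ c_v ∈ K`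
is joined to `v₀ δ` inside `S δ`. -/
theorem eventually_pathIn_of_isCompact {U : Set ℂ} {ρ : ℝ} {p : Fin 2 → ℂ} {m : Fin 2 → ℝ → ℤ}
    {S : ℝ → Set HexVertex} {v₀ : ℝ → HexVertex} {x₀ : ℂ}
    (hUo : IsOpen U) (hUc : IsConnected U)
    (hfl : ∀ i, U ∩ ball (p i) ρ = {z : ℂ | (p i).im < z.im} ∩ ball (p i) ρ) (hρ : 0 < ρ)
    (hmhi : ∀ i, Tendsto (fun δ : ℝ => ((m i δ : ℝ) + 1 / 3) * (δ * (Real.sqrt 3 / 2))) (𝓝[>] 0)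
      (𝓝 (p i).im))
    (hS : ∀ δ : ℝ, ∀ u, u ∈ S δ ↔ ((δ : ℂ) * hexCenter u ∈ U ∧
      (∀ i, (δ : ℂ) * hexCenter u ∈ ball (p i) (ρ / 2) → m i δ ≤ u.1 1) ∧
      closedBall ((δ : ℂ) * hexCenter u) (70 * δ) ⊆ U ∪ ball (p 0) (5 * ρ / 8) ∪ ball (p 1) (5 * ρ / 8)))
    (hx₀ : x₀ ∈ U) (hv₀ : ∀ δ : ℝ, 0 < δ → dist ((δ : ℂ) * hexCenter (v₀ δ)) x₀ ≤ δ)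
    {K : Set ℂ} (hK : IsCompact K) (hKU : K ⊆ U) :
    ∀ᶠ δ : ℝ in 𝓝[>] 0, ∀ v : HexVertex, (δ : ℂ) * hexCenter v ∈ K → PathIn hexGraph (S δ) (v₀ δ) v := by
  obtain ⟨ε, hε, hwalk⟩ := exists_walk_deep_of_isCompact hUo hUc hK hKU hx₀
  -- the depth `r δ = 70δ + |c 0 δ| + |c 1 δ|` tends to `0`
  set c : Fin 2 → ℝ → ℝ := fun i δ => ((m i δ : ℝ) + 1 / 3) * (δ * (Real.sqrt 3 / 2)) - (p i).im
    with hc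
  set r : ℝ → ℝ := fun δ => 70 * δ + |c 0 δ| + |c 1 δ| with hr
  have hc0 : ∀ i, Tendsto (fun δ => |c i δ|) (𝓝[>] 0) (𝓝 0) := by
    intro i
    have h := (hmhi i).sub_const (p i).im
    rw [sub_self] at h
    have h2 := h.abs
    rw [abs_zero] at h2
    exact h2
  have hδ0 : Tendsto (fun δ : ℝ => 70 * δ) (𝓝[>] 0) (𝓝 0) := by
    have : Tendsto (fun δ : ℝ => 70 * δ) (𝓝 0) (𝓝 (70 * 0)) :=
      (continuous_const.mul continuous_id).tendsto 0
    rw [mul_zero] at this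
    exact this.mono_left nhdsWithin_le_nhds
  have hr0 : Tendsto r (𝓝[>] 0) (𝓝 0) := by
    have := (hδ0.add (hc0 0)).add (hc0 1)
    simpa [hr] using this
  have hr_small : ∀ᶠ δ : ℝ in 𝓝[>] 0, r δ < min (ε / 2) (ρ / 2) := by
    have hpos : 0 < min (ε / 2) (ρ / 2) := lt_min (half_pos hε) (half_pos hρ)
    exact (Metric.tendsto_nhds.1 hr0) _ hpos |>.mono fun δ hδ => by
      rw [Real.dist_eq, sub_zero] at hδ
      exact (le_abs_self _).trans_lt hδ
  have hδ_small : ∀ᶠ δ : ℝ in 𝓝[>] 0, δ ∈ Ioo (0 : ℝ) (ε / 8) := Ioo_mem_nhdsGT (by positivity)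
  filter_upwards [hr_small, hδ_small] with δ hrδ hδ v hv
  have hδ0' : 0 < δ := hδ.1
  have hrε : r δ < ε / 2 := hrδ.trans_le (min_le_left _ _)
  have hrρ : r δ < ρ / 2 := hrδ.trans_le (min_le_right _ _)
  have h70 : 70 * δ ≤ r δ := by
    show 70 * δ ≤ 70 * δ + |c 0 δ| + |c 1 δ|
    have := abs_nonneg (c 0 δ); have := abs_nonneg (c 1 δ); linarith
  have hmr : ∀ i, ((m i δ : ℝ) + 1 / 3) * (δ * (Real.sqrt 3 / 2)) ≤ (p i).im + r δ := by
    intro i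
    have h1 : c i δ ≤ |c i δ| := le_abs_self _
    have h2 : |c i δ| ≤ r δ := by
      have := abs_nonneg (c 0 δ); have := abs_nonneg (c 1 δ)
      fin_cases i
      · show |c 0 δ| ≤ 70 * δ + |c 0 δ| + |c 1 δ|; linarith
      · show |c 1 δ| ≤ 70 * δ + |c 0 δ| + |c 1 δ|; linarith
    have h3 : c i δ = ((m i δ : ℝ) + 1 / 3) * (δ * (Real.sqrt 3 / 2)) - (p i).im := rfl
    linarith
  obtain ⟨q, hq⟩ := hwalk δ (r δ) hδ0' (by linarith [hδ.2]) (v₀ δ) v (hv₀ δ hδ0') hv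
  exact pathIn_of_walk q fun u hu =>
    mem_deep_of_closedBall_subset hfl hδ0' h70 hrρ hmr (hS δ) (hq u hu)

/-- **Registered sub-goal `stub_carvedReduction_twoPieceFamily`** (crux item stmt-CriticalPhenomena-14005,
stub 5a4′ `stub_carvedReduction_squeeze`, piece (G4′d) NESTED ADMISSIBLE FAMILIES OF TWO-PIECE FLAT
DOMAINS WITH PRESCRIBED ROWS AND GATES): see the module docstring. -/
theorem stub_carvedReduction_twoPieceFamily :
    ∀ (Ω Ω' : Set ℂ) (ρ : ℝ) (p : Fin 2 → ℂ) (m : Fin 2 → ℝ → ℤ) (g : Fin 2 → ℝ → Site 2),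
      IsOpen Ω → IsConnected Ω → Bornology.IsBounded Ω → IsConnected (closure Ω)ᶜ →
      frontier (closure Ω)ᶜ = frontier Ω →
      IsOpen Ω' → IsConnected Ω' → IsConnected (closure Ω')ᶜ → frontier (closure Ω')ᶜ = frontier Ω' →
      Ω' ⊆ Ω → 0 < ρ → 2 * ρ ≤ dist (p 0) (p 1) →
      (∀ i, Ω ∩ ball (p i) ρ = {z : ℂ | (p i).im < z.im} ∩ ball (p i) ρ) →
      (∀ i, Ω' ∩ ball (p i) ρ = {z : ℂ | (p i).im < z.im} ∩ ball (p i) ρ) →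
      (∀ i, ∀ᶠ δ : ℝ in 𝓝[>] 0, (p i).im < ((m i δ : ℝ) + 1 / 3) * (δ * (Real.sqrt 3 / 2))) →
      (∀ i, Tendsto (fun δ : ℝ => ((m i δ : ℝ) + 1 / 3) * (δ * (Real.sqrt 3 / 2))) (𝓝[>] 0)
        (𝓝 (p i).im)) →
      (∀ i, ∀ᶠ δ : ℝ in 𝓝[>] 0, g i δ 1 = m i δ) →
      (∀ i, Tendsto (fun δ : ℝ => (δ : ℂ) * hexCenter ((g i δ, 0) : HexVertex)) (𝓝[>] 0) (𝓝 (p i))) →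
      ∃ Λ Λ' : ℝ → Finset HexVertex,
        (∀ᶠ δ : ℝ in 𝓝[>] 0, Λ' δ ⊆ Λ δ ∧
          hexDomainSimplyConnected (Λ δ) ∧ hexDomainSimplyConnected (Λ' δ) ∧
          (hexGraph.induce (↑(Λ δ) : Set HexVertex)).Preconnected ∧
          (hexGraph.induce (↑(Λ' δ) : Set HexVertex)).Preconnected ∧
          (∀ v ∈ Λ δ, (δ : ℂ) * hexCenter v ∈ Ω) ∧ (∀ v ∈ Λ' δ, (δ : ℂ) * hexCenter v ∈ Ω') ∧
          (∀ i, ∀ v : HexVertex, (δ : ℂ) * hexCenter v ∈ ball (p i) (ρ / 16) →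
            ((v ∈ Λ δ ↔ m i δ ≤ v.1 1) ∧ (v ∈ Λ' δ ↔ m i δ ≤ v.1 1))) ∧
          (∀ i, s(((g i δ, 0) : HexVertex), (g i δ - Pi.single 1 1, 1)) ∈ hexDomainBoundary (Λ δ) ∧
            s(((g i δ, 0) : HexVertex), (g i δ - Pi.single 1 1, 1)) ∈ hexDomainBoundary (Λ' δ)) ∧
          Nonempty (HexMidEdgeSAW (Λ δ) s(((g 0 δ, 0) : HexVertex), (g 0 δ - Pi.single 1 1, 1))
            s(((g 1 δ, 0) : HexVertex), (g 1 δ - Pi.single 1 1, 1))) ∧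
          Nonempty (HexMidEdgeSAW (Λ' δ) s(((g 0 δ, 0) : HexVertex), (g 0 δ - Pi.single 1 1, 1))
            s(((g 1 δ, 0) : HexVertex), (g 1 δ - Pi.single 1 1, 1)))) ∧
        (∀ K : Set ℂ, IsCompact K → K ⊆ Ω →
          ∀ᶠ δ : ℝ in 𝓝[>] 0, ∀ v : HexVertex, (δ : ℂ) * hexCenter v ∈ K → v ∈ Λ δ) ∧
        (∀ K : Set ℂ, IsCompact K → K ⊆ Ω' →
          ∀ᶠ δ : ℝ in 𝓝[>] 0, ∀ v : HexVertex, (δ : ℂ) * hexCenter v ∈ K → v ∈ Λ' δ) ∧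
        (∀ i, Tendsto (fun δ : ℝ => (δ : ℂ) *
          hexMidpoint s(((g i δ, 0) : HexVertex), (g i δ - Pi.single 1 1, 1))) (𝓝[>] 0) (𝓝 (p i))) := by
  intro Ω Ω' ρ p m g hΩo hΩc hΩb hE hEfr hΩ'o hΩ'c hE' hEfr' hsub hρ hsep hfl hfl' hmlo hmhi hg hglim
  classical
  -- a common bound for `Ω ⊇ Ω'`
  obtain ⟨R, -, hΩR'⟩ := hΩb.subset_ball_lt 0 0
  have hΩR : ∀ z ∈ Ω, ‖z‖ < R := fun z hz => mem_ball_zero_iff.1 (hΩR' hz)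
  have hΩ'R : ∀ z ∈ Ω', ‖z‖ < R := fun z hz => hΩR z (hsub hz)
  -- the deep sets
  set S : ℝ → Set HexVertex := fun δ => {u | (δ : ℂ) * hexCenter u ∈ Ω ∧
      (∀ i, (δ : ℂ) * hexCenter u ∈ ball (p i) (ρ / 2) → m i δ ≤ u.1 1) ∧
      closedBall ((δ : ℂ) * hexCenter u) (70 * δ) ⊆ Ω ∪ ball (p 0) (5 * ρ / 8) ∪ ball (p 1) (5 * ρ / 8)}
  set S' : ℝ → Set HexVertex := fun δ => {u | (δ : ℂ) * hexCenter u ∈ Ω' ∧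
      (∀ i, (δ : ℂ) * hexCenter u ∈ ball (p i) (ρ / 2) → m i δ ≤ u.1 1) ∧
      closedBall ((δ : ℂ) * hexCenter u) (70 * δ) ⊆ Ω' ∪ ball (p 0) (5 * ρ / 8) ∪ ball (p 1) (5 * ρ / 8)}
  have hS : ∀ δ : ℝ, ∀ u, u ∈ S δ ↔ ((δ : ℂ) * hexCenter u ∈ Ω ∧
      (∀ i, (δ : ℂ) * hexCenter u ∈ ball (p i) (ρ / 2) → m i δ ≤ u.1 1) ∧
      closedBall ((δ : ℂ) * hexCenter u) (70 * δ) ⊆ Ω ∪ ball (p 0) (5 * ρ / 8) ∪ ball (p 1) (5 * ρ / 8)) :=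
    fun δ u => Iff.rfl
  have hS' : ∀ δ : ℝ, ∀ u, u ∈ S' δ ↔ ((δ : ℂ) * hexCenter u ∈ Ω' ∧
      (∀ i, (δ : ℂ) * hexCenter u ∈ ball (p i) (ρ / 2) → m i δ ≤ u.1 1) ∧
      closedBall ((δ : ℂ) * hexCenter u) (70 * δ) ⊆ Ω' ∪ ball (p 0) (5 * ρ / 8) ∪ ball (p 1) (5 * ρ / 8)) :=
    fun δ u => Iff.rfl
  have hS'S : ∀ δ, S' δ ⊆ S δ := by
    rintro δ u ⟨h1, h2, h3⟩
    exact ⟨hsub h1, h2, h3.trans (union_subset_union_left _ (union_subset_union_left _ hsub))⟩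
  -- base point, base vertices
  set x₀ : ℂ := p 0 + ((ρ / 4 : ℝ) : ℂ) * Complex.I with hx₀
  -- the target discs `B̄(p i + iρ/4, ρ/8)` lie in `Ω'`
  set T : Fin 2 → Set ℂ := fun i => closedBall (p i + ((ρ / 4 : ℝ) : ℂ) * Complex.I) (ρ / 8) with hT
  have hTΩ' : ∀ i, T i ⊆ Ω' := by
    intro i x hx
    have hx' := mem_closedBall.1 hx
    have him : (p i + ((ρ / 4 : ℝ) : ℂ) * Complex.I).im = (p i).im + ρ / 4 := by simp
    have hce : dist (p i + ((ρ / 4 : ℝ) : ℂ) * Complex.I) (p i) = ρ / 4 := by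
      rw [dist_eq_norm, add_sub_cancel_left, norm_mul, Complex.norm_real, Complex.norm_I, mul_one,
        Real.norm_of_nonneg (by positivity)]
    have : x ∈ {z : ℂ | (p i).im < z.im} ∩ ball (p i) ρ := by
      refine ⟨?_, ?_⟩
      · show (p i).im < x.im
        have h1 : (p i + ((ρ / 4 : ℝ) : ℂ) * Complex.I).im - x.im ≤
            dist x (p i + ((ρ / 4 : ℝ) : ℂ) * Complex.I) := by
          rw [dist_comm, dist_eq_norm, ← Complex.sub_im]; exact Complex.im_le_norm _
        linarith
      · rw [mem_ball]
        calc dist x (p i) ≤ dist x (p i + ((ρ / 4 : ℝ) : ℂ) * Complex.I) +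
              dist (p i + ((ρ / 4 : ℝ) : ℂ) * Complex.I) (p i) := dist_triangle _ _ _
          _ ≤ ρ / 8 + ρ / 4 := by rw [hce]; exact add_le_add hx' le_rfl
          _ < ρ := by linarith
    rw [← hfl' i] at this
    exact this.1
  have hx₀Ω' : x₀ ∈ Ω' := hTΩ' 0 (mem_closedBall_self (by positivity))
  have hx₀Ω : x₀ ∈ Ω := hsub hx₀Ω'
  set v₀ : ℝ → HexVertex := fun δ =>
    if hδ : 0 < δ then (exists_vertex_dist_le hδ x₀).choose else ((0 : Site 2), (0 : Fin 2)) with hv₀def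
  have hv₀ : ∀ δ : ℝ, 0 < δ → dist ((δ : ℂ) * hexCenter (v₀ δ)) x₀ ≤ δ := by
    intro δ hδ
    have : v₀ δ = (exists_vertex_dist_le hδ x₀).choose := by rw [hv₀def]; simp only [dif_pos hδ]
    rw [this]; exact (exists_vertex_dist_le hδ x₀).choose_spec
  -- the admissibility condition at mesh `δ` and the two families
  set cond : ℝ → Prop := fun δ => 0 < δ ∧ 2000 * δ ≤ ρ ∧
    ∀ i, ((m i δ : ℝ) + 1 / 3) * (δ * (Real.sqrt 3 / 2)) ≤ (p i).im + ρ / 16 with hcond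
  have key : ∀ δ, cond δ → ∃ Λ : Finset HexVertex, hexDomainSimplyConnected Λ ∧
      (hexGraph.induce (↑Λ : Set HexVertex)).Preconnected ∧
      (∀ z : HexVertex, PathIn hexGraph (S δ) (v₀ δ) z → z ∈ Λ) ∧
      (∀ z ∈ Λ, (δ : ℂ) * hexCenter z ∈ Ω) ∧
      (∀ z ∈ Λ, ∀ i, dist ((δ : ℂ) * hexCenter z) (p i) < ρ / 16 → m i δ ≤ z.1 1) ∧
      (∀ z : HexVertex, z ∈ Λ ↔ ¬ ∃ w : HexVertex, R + ρ + 5 * δ ≤ ‖(δ : ℂ) * hexCenter w‖ ∧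
        PathIn hexGraph {x | PathIn hexGraph (S δ) (v₀ δ) x}ᶜ z w) := fun δ h =>
    exists_twoPieceInner hE hEfr hΩR hfl hsep hρ h.1 (by linarith [h.2.1]) h.2.2 (hS δ) (v₀ δ)
  have key' : ∀ δ, cond δ → ∃ Λ : Finset HexVertex, hexDomainSimplyConnected Λ ∧
      (hexGraph.induce (↑Λ : Set HexVertex)).Preconnected ∧
      (∀ z : HexVertex, PathIn hexGraph (S' δ) (v₀ δ) z → z ∈ Λ) ∧
      (∀ z ∈ Λ, (δ : ℂ) * hexCenter z ∈ Ω') ∧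
      (∀ z ∈ Λ, ∀ i, dist ((δ : ℂ) * hexCenter z) (p i) < ρ / 16 → m i δ ≤ z.1 1) ∧
      (∀ z : HexVertex, z ∈ Λ ↔ ¬ ∃ w : HexVertex, R + ρ + 5 * δ ≤ ‖(δ : ℂ) * hexCenter w‖ ∧
        PathIn hexGraph {x | PathIn hexGraph (S' δ) (v₀ δ) x}ᶜ z w) := fun δ h =>
    exists_twoPieceInner hE' hEfr' hΩ'R hfl' hsep hρ h.1 (by linarith [h.2.1]) h.2.2 (hS' δ) (v₀ δ)
  set Λ : ℝ → Finset HexVertex := fun δ => if h : cond δ then (key δ h).choose else ∅ with hΛdef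
  set Λ' : ℝ → Finset HexVertex := fun δ => if h : cond δ then (key' δ h).choose else ∅ with hΛ'def
  have hΛ : ∀ δ (h : cond δ), hexDomainSimplyConnected (Λ δ) ∧
      (hexGraph.induce (↑(Λ δ) : Set HexVertex)).Preconnected ∧
      (∀ z : HexVertex, PathIn hexGraph (S δ) (v₀ δ) z → z ∈ Λ δ) ∧
      (∀ z ∈ Λ δ, (δ : ℂ) * hexCenter z ∈ Ω) ∧
      (∀ z ∈ Λ δ, ∀ i, dist ((δ : ℂ) * hexCenter z) (p i) < ρ / 16 → m i δ ≤ z.1 1) ∧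
      (∀ z : HexVertex, z ∈ Λ δ ↔ ¬ ∃ w : HexVertex, R + ρ + 5 * δ ≤ ‖(δ : ℂ) * hexCenter w‖ ∧
        PathIn hexGraph {x | PathIn hexGraph (S δ) (v₀ δ) x}ᶜ z w) := by
    intro δ h
    have e : Λ δ = (key δ h).choose := by rw [hΛdef]; simp only [dif_pos h]
    rw [e]; exact (key δ h).choose_spec
  have hΛ' : ∀ δ (h : cond δ), hexDomainSimplyConnected (Λ' δ) ∧
      (hexGraph.induce (↑(Λ' δ) : Set HexVertex)).Preconnected ∧
      (∀ z : HexVertex, PathIn hexGraph (S' δ) (v₀ δ) z → z ∈ Λ' δ) ∧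
      (∀ z ∈ Λ' δ, (δ : ℂ) * hexCenter z ∈ Ω') ∧
      (∀ z ∈ Λ' δ, ∀ i, dist ((δ : ℂ) * hexCenter z) (p i) < ρ / 16 → m i δ ≤ z.1 1) ∧
      (∀ z : HexVertex, z ∈ Λ' δ ↔ ¬ ∃ w : HexVertex, R + ρ + 5 * δ ≤ ‖(δ : ℂ) * hexCenter w‖ ∧
        PathIn hexGraph {x | PathIn hexGraph (S' δ) (v₀ δ) x}ᶜ z w) := by
    intro δ h
    have e : Λ' δ = (key' δ h).choose := by rw [hΛ'def]; simp only [dif_pos h]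
    rw [e]; exact (key' δ h).choose_spec
  -- eventually the condition holds
  have hcond_ev : ∀ᶠ δ : ℝ in 𝓝[>] 0, cond δ := by
    have h1 : ∀ᶠ δ : ℝ in 𝓝[>] 0, δ ∈ Ioc (0 : ℝ) (ρ / 2000) := Ioc_mem_nhdsGT (by positivity)
    have h2 : ∀ i, ∀ᶠ δ : ℝ in 𝓝[>] 0,
        ((m i δ : ℝ) + 1 / 3) * (δ * (Real.sqrt 3 / 2)) ≤ (p i).im + ρ / 16 := fun i =>
      ((hmhi i).eventually (Iio_mem_nhds (show (p i).im < (p i).im + ρ / 16 by linarith))).mono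
        fun δ hδ => le_of_lt hδ
    filter_upwards [h1, h2 0, h2 1] with δ hδ h0 h1'
    refine ⟨hδ.1, by linarith [hδ.2], fun i => ?_⟩
    fin_cases i
    · exact h0
    · exact h1'
  -- deep walks to the two target discs, inside `S'`
  have hTev : ∀ᶠ δ : ℝ in 𝓝[>] 0, ∀ i, ∀ z : HexVertex, (δ : ℂ) * hexCenter z ∈ T i →
      PathIn hexGraph (S' δ) (v₀ δ) z := by
    have h := eventually_pathIn_of_isCompact hΩ'o hΩ'c hfl' hρ hmhi hS' hx₀Ω' hv₀
      ((isCompact_closedBall _ _).union (isCompact_closedBall _ _)) (union_subset (hTΩ' 0) (hTΩ' 1))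
    filter_upwards [h] with δ hδ i z hz
    refine hδ z ?_
    fin_cases i
    · exact Or.inl hz
    · exact Or.inr hz
  -- the gate up-faces approach the window centres
  have hgnear : ∀ i, ∀ᶠ δ : ℝ in 𝓝[>] 0, dist ((δ : ℂ) * hexCenter ((g i δ, 0) : HexVertex)) (p i) < ρ / 32 :=
    fun i => (Metric.tendsto_nhds.1 (hglim i)) _ (by positivity)
  refine ⟨Λ, Λ', ?_, ?_, ?_, fun i => tendsto_smul_hexMidpoint (hglim i)
    (Eventually.of_forall fun δ => hexGraph_adj_below (g i δ))⟩
  · -- THE MAIN EVENTUAL CLAUSE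
    filter_upwards [hcond_ev, hTev, hmlo 0, hmlo 1, hg 0, hg 1, hgnear 0, hgnear 1] with δ hc hTδ
      hm0 hm1 hg0 hg1 hn0 hn1
    obtain ⟨hδ, h2000, hc3⟩ := hc
    have hc : cond δ := ⟨hδ, h2000, hc3⟩
    have hmloδ : ∀ i, (p i).im < ((m i δ : ℝ) + 1 / 3) * (δ * (Real.sqrt 3 / 2)) := by
      intro i; fin_cases i
      · exact hm0
      · exact hm1
    have hgδ : ∀ i, g i δ 1 = m i δ := by
      intro i; fin_cases i
      · exact hg0
      · exact hg1
    have hnδ : ∀ i, dist ((δ : ℂ) * hexCenter ((g i δ, 0) : HexVertex)) (p i) < ρ / 32 := by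
      intro i; fin_cases i
      · exact hn0
      · exact hn1
    obtain ⟨hsc, hconn, hGΛ, hΛΩ, hrow, hchar⟩ := hΛ δ hc
    obtain ⟨hsc', hconn', hGΛ', hΛΩ', hrow', hchar'⟩ := hΛ' δ hc
    -- nesting
    have hGG' : {x | PathIn hexGraph (S' δ) (v₀ δ) x} ⊆ {x | PathIn hexGraph (S δ) (v₀ δ) x} :=
      fun x hx => hx.mono (hS'S δ)
    have hnest : Λ' δ ⊆ Λ δ := by
      intro z hz
      refine (hchar z).2 fun ⟨w, hw, hzw⟩ => (hchar' z).1 hz ⟨w, hw, ?_⟩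
      exact hzw.mono (compl_subset_compl.2 hGG')
    -- exact rows, direction `←` (ascent)
    have hK : ∀ i, ∀ z : HexVertex, (δ : ℂ) * hexCenter z ∈ T i → PathIn hexGraph (S δ) (v₀ δ) z :=
      fun i z hz => (hTδ i z hz).mono (hS'S δ)
    have hasc : ∀ i (v : HexVertex), dist ((δ : ℂ) * hexCenter v) (p i) < ρ / 16 → m i δ ≤ v.1 1 →
        v ∈ Λ δ := fun i v hvi hrv =>
      hGΛ v (pathIn_of_near_window hfl hsep hρ hδ h2000 hmloδ (hS δ) (hK i) hvi hrv)
    have hasc' : ∀ i (v : HexVertex), dist ((δ : ℂ) * hexCenter v) (p i) < ρ / 16 → m i δ ≤ v.1 1 →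
        v ∈ Λ' δ := fun i v hvi hrv =>
      hGΛ' v (pathIn_of_near_window hfl' hsep hρ hδ h2000 hmloδ (hS' δ) (hTδ i) hvi hrv)
    -- the gate faces: up-face in, down-face out
    have hup : ∀ i, dist ((δ : ℂ) * hexCenter ((g i δ, 0) : HexVertex)) (p i) < ρ / 16 :=
      fun i => (hnδ i).trans (by linarith)
    have hdown : ∀ i, dist ((δ : ℂ) * hexCenter ((g i δ - Pi.single 1 1, 1) : HexVertex)) (p i) < ρ / 16 := by
      intro i
      have h1 := dist_smul_hexCenter_le_of_adj hδ.le (hexGraph_adj_below (g i δ))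
      have h2 := dist_triangle ((δ : ℂ) * hexCenter ((g i δ - Pi.single 1 1, 1) : HexVertex))
        ((δ : ℂ) * hexCenter ((g i δ, 0) : HexVertex)) (p i)
      have h3 := hnδ i
      linarith
    have hrow_down : ∀ i, ((g i δ - Pi.single 1 1, (1 : Fin 2)) : HexVertex).1 1 < m i δ := by
      intro i
      have e : ((g i δ - Pi.single 1 1, (1 : Fin 2)) : HexVertex).1 1 = g i δ 1 - 1 := by
        simp [Pi.sub_apply]
      rw [e, hgδ i]
      linarith
    have hrow_up : ∀ i, m i δ ≤ ((g i δ, (0 : Fin 2)) : HexVertex).1 1 := fun i => le_of_eq (hgδ i).symm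
    have hupΛ : ∀ i, ((g i δ, 0) : HexVertex) ∈ Λ δ := fun i => hasc i _ (hup i) (hrow_up i)
    have hupΛ' : ∀ i, ((g i δ, 0) : HexVertex) ∈ Λ' δ := fun i => hasc' i _ (hup i) (hrow_up i)
    have hdownΛ : ∀ i, ((g i δ - Pi.single 1 1, 1) : HexVertex) ∉ Λ δ :=
      fun i h => (not_le.2 (hrow_down i)) (hrow _ h i (hdown i))
    have hdownΛ' : ∀ i, ((g i δ - Pi.single 1 1, 1) : HexVertex) ∉ Λ' δ :=
      fun i h => (not_le.2 (hrow_down i)) (hrow' _ h i (hdown i))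
    -- the two gate mid-edges are distinct (their up-faces are near `p 0`, `p 1`)
    have hfar : ∀ (a b : HexVertex), dist ((δ : ℂ) * hexCenter a) (p 0) < ρ / 16 →
        dist ((δ : ℂ) * hexCenter b) (p 1) < ρ / 16 → a ≠ b := by
      rintro a b ha hb rfl
      have := dist_triangle_left (p 0) (p 1) ((δ : ℂ) * hexCenter a)
      linarith
    have hne : s(((g 0 δ - Pi.single 1 1, 1) : HexVertex), ((g 0 δ, 0) : HexVertex)) ≠
        s(((g 1 δ - Pi.single 1 1, 1) : HexVertex), ((g 1 δ, 0) : HexVertex)) := by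
      intro h
      rw [Sym2.eq_iff] at h
      rcases h with ⟨-, h2⟩ | ⟨h1, -⟩
      · exact hfar _ _ (hup 0) (hup 1) h2
      · exact hfar _ _ (hdown 0) (hup 1) h1
    have hswap : ∀ i, s(((g i δ, 0) : HexVertex), ((g i δ - Pi.single 1 1, 1) : HexVertex)) =
        s(((g i δ - Pi.single 1 1, 1) : HexVertex), ((g i δ, 0) : HexVertex)) := fun i => Sym2.eq_swap
    refine ⟨hnest, hsc, hsc', hconn, hconn', hΛΩ, hΛΩ', fun i v hv => ?_, fun i => ?_, ?_, ?_⟩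
    · have hvi : dist ((δ : ℂ) * hexCenter v) (p i) < ρ / 16 := mem_ball.1 hv
      exact ⟨⟨fun h => hrow v h i hvi, hasc i v hvi⟩, ⟨fun h => hrow' v h i hvi, hasc' i v hvi⟩⟩
    · exact ⟨(mem_hexDomainBoundary_of_adj (hupΛ i) (hdownΛ i) (hexGraph_adj_below (g i δ))).1,
        (mem_hexDomainBoundary_of_adj (hupΛ' i) (hdownΛ' i) (hexGraph_adj_below (g i δ))).1⟩
    · rw [hswap 0, hswap 1]
      exact nonempty_hexMidEdgeSAW_of_preconnected hconn (hexGraph_adj_below (g 0 δ)).symm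
        (hdownΛ 0) (hupΛ 0) (hdownΛ 1) (hupΛ 1) hne
    · rw [hswap 0, hswap 1]
      exact nonempty_hexMidEdgeSAW_of_preconnected hconn' (hexGraph_adj_below (g 0 δ)).symm
        (hdownΛ' 0) (hupΛ' 0) (hdownΛ' 1) (hupΛ' 1) hne
  · -- exhaustion of the compacts of `Ω`
    intro K hK hKΩ
    filter_upwards [hcond_ev, eventually_pathIn_of_isCompact hΩo hΩc hfl hρ hmhi hS hx₀Ω hv₀ hK hKΩ]
      with δ hc hKδ v hv
    exact (hΛ δ hc).2.2.1 v (hKδ v hv)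
  · -- exhaustion of the compacts of `Ω'`
    intro K hK hKΩ'
    filter_upwards [hcond_ev, eventually_pathIn_of_isCompact hΩ'o hΩ'c hfl' hρ hmhi hS' hx₀Ω' hv₀ hK hKΩ']
      with δ hc hKδ v hv
    exact (hΛ' δ hc).2.2.1 v (hKδ v hv)

end Summit.CriticalPhenomena.SAWScalingLimit.Theorems.ObservableToSLER.Squeeze

end
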